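import Summits.Ventures.QEC.Census.CertBZInfoSets
import Summits.Ventures.QEC.Census.CertPopcount
import HarnessLib

/-!
# Meet-in-the-middle replay of the Brouwer–Zimmermann enumeration (kernel words) — qec-search-9 (g2)

For one enumeration matrix `G_i` (rows `giRows Gb mt`, `kb` rows, systematic on the information set `T_i`, words
`< 2^n`) of a `bz`/`bz_aut` certificate (CERT-FORMAT v1 §5.3; `Census/CertCheckBZ.lean`), the claim of C4 —
  every selection `u` with `1 ≤ |u| ≤ t_i` whose codeword `c = ⊕_{j∈u} G_i[j]` has `popc c ≤ W` is allow-listed —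
is replayed WITHOUT visiting all `Σ_{w≤t} C(kb,w)` selections (`t_i ≤ 5`): `|u| ≤ 3` directly; `|u| = 4, 5` by
an exact collision of the two smallest indices `(i,j)` of `u` (TABLE = all pairs, keyed by a hash of the bits of
`G[i] ⊕ G[j]` on one column group) against the remaining `2, 3` indices (PROBES), on one of `W + 1 − |u|`
disjoint groups of REDUNDANCY columns (columns outside `T_i`): the codeword of `u` has exactly `|u|` bits on the
`T`-columns (systematic form), hence at most `W − |u|` on the redundancy columns, and so misses one of the groups
(pigeonhole); on that group the table key and the probe key coincide.  The tables are arrays of fixed-width slots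
packed into numerals, BUILT BY THE KERNEL from the matrix and verified by a self-lookup (T1), so no property of the
table layout, the hash or the slot encoding is trusted (the `CertCheckMitm` L4 pattern): lookups are arbitrary
functions of the key.  Hot loops use only kernel-accelerated `Nat` operations (`&&&`, `|||`, `^^^`, `>>>`, `<<<`,
`%`, `Nat.beq`, `Nat.ble`, and the byte-parallel popcount of `Census/CertPopcount.lean`).
-/

namespace Summit.Ventures.QEC.Census

/-! ## Kernel words -/

/-- The rows with their indices: `idxRows [g₀, g₁, …] k₀ = [(k₀, g₀), (k₀+1, g₁), …]`. (definition) -/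
def idxRows : List ℕ → ℕ → List (ℕ × ℕ)
  | [], _ => []
  | g :: gs, k => (k, g) :: idxRows gs (k + 1)

/-- All pairs of an indexed row list, in order, with the XOR of the two rows: `(i, j, G[i] ⊕ G[j])`, `i` before `j`.
(definition, structural) -/
def pairXT : List (ℕ × ℕ) → List (ℕ × ℕ × ℕ)
  | [] => []
  | p :: rest => rest.map (fun q => (p.1, q.1, p.2 ^^^ q.2)) ++ pairXT rest

/-- The leaf test on a word of at most `B` bytes: more than `W` set bits (byte-parallel popcount `popcFold` of
`Census/CertPopcount.lean`) or allow-listed. (definition) -/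
def mitmLeaf (B W : ℕ) (allow : List ℕ) (c : ℕ) : Bool := Nat.blt W (popcFold B c) || allow.any (Nat.beq c)

/-! ### Column groups (redundancy columns dealt round-robin) -/

/-- The redundancy columns of a matrix systematic on `T`: the columns `q < n` not in `T`, ascending. (definition) -/
def redCols (n : ℕ) (T : List ℕ) : List ℕ := (List.range n).filter fun q => !(T.any (Nat.beq q))

/-- Deal a column list round-robin into `s` groups and return the mask of group `g`: the columns whose rank `r`
(position in the list, counted from `r₀`) has `r % s = g`. (definition) -/
def dealMask : List ℕ → ℕ → ℕ → ℕ → ℕ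
  | [], _, _, _ => 0
  | q :: qs, s, g, r => (if r % s = g then 2 ^ q else 0) ||| dealMask qs s g (r + 1)

/-- The absolute column mask of group `g` of `s` for a matrix systematic on `T`. (definition) -/
def groupMask (n : ℕ) (T : List ℕ) (s g : ℕ) : ℕ := dealMask (redCols n T) s g 0

/-- CHECKED side conditions on the `s` column groups (so that nothing about their construction need be proved):
every group mask avoids the `T`-columns, lies below `2^n`, and the masks are pairwise disjoint. (definition) -/
def groupsOK (n : ℕ) (T : List ℕ) (s : ℕ) : Bool :=
  (List.range s).all fun g =>
    (groupMask n T s g &&& maskOf T == 0) && decide (groupMask n T s g < 2 ^ n) &&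
      (List.range s).all fun g' => (g == g') || (groupMask n T s g &&& groupMask n T s g' == 0)

/-- The small key of a word `x` for the group mask `A`: a hash of its bits on the group's columns. (definition) -/
def gkey (A x : ℕ) : ℕ := (x &&& A) % 7919

/-! ### Slot tables packed into numerals -/

/-- Slot `k` (24 bits wide) of a packed table numeral. (definition) -/
def slot (tb k : ℕ) : ℕ := (tb >>> (k * 24)) &&& (2 ^ 24 - 1)

/-- The slot value of the table entry (pair) number `p` with larger index `j`: nonzero marker, `j`, `p`.
(definition) -/
def encE (j p : ℕ) : ℕ := 1 ||| (j <<< 1) ||| (p <<< 9)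

/-- The larger row index recorded in a slot value. (definition) -/
def decJ (v : ℕ) : ℕ := (v >>> 1) &&& 255

/-- The pair number recorded in a slot value. (definition) -/
def decP (v : ℕ) : ℕ := v >>> 9

/-- Insert the slot value `v` at key `k` into the first table of the list whose slot `k` is empty (appending a new
table if none). (definition, structural) -/
def tabIns : List ℕ → ℕ → ℕ → List ℕ
  | [], k, v => [v <<< (k * 24)]
  | tb :: rest, k, v => cond (Nat.beq (slot tb k) 0) ((tb ||| (v <<< (k * 24))) :: rest) (tb :: tabIns rest k v)

/-- The slot values at key `k`, table by table, up to the first empty slot (an ARBITRARY function of `k` as far as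
the soundness proofs are concerned). (definition, structural) -/
def tabFind (k : ℕ) : List ℕ → List ℕ
  | [] => []
  | tb :: rest => cond (Nat.beq (slot tb k) 0) [] (slot tb k :: tabFind k rest)

/-- Field `p` (width `n`) of the packed pair-array numeral: the word of pair number `p`. (definition) -/
def pairX (n pa p : ℕ) : ℕ := (pa >>> (p * n)) &&& (2 ^ n - 1)

/-- Build the slot tables and the pair array from the pair list (pair number = position, from `p₀`).
(definition, structural) -/
def buildTabs (A n : ℕ) : List (ℕ × ℕ × ℕ) → ℕ → List ℕ × ℕ → List ℕ × ℕ
  | [], _, acc => acc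
  | e :: es, p, (tabs, pa) => buildTabs A n es (p + 1) (tabIns tabs (gkey A e.2.2) (encE e.2.1 p), pa ||| (e.2.2 <<< (p * n)))

/-- (T1) every pair (number `p`, larger index `j`, word `x`) is found: the pair array holds `x` at `p`, the slot
value `encE j p` decodes to `(j, p)`, and it occurs among the slot values at the key of `x`. (definition, structural) -/
def t1OK (A n : ℕ) (tp : List ℕ × ℕ) : List (ℕ × ℕ × ℕ) → ℕ → Bool
  | [], _ => true
  | e :: es, p =>
    (Nat.beq (pairX n tp.2 p) e.2.2 && Nat.beq (decJ (encE e.2.1 p)) e.2.1 && Nat.beq (decP (encE e.2.1 p)) p &&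
      (tabFind (gkey A e.2.2) tp.1).any (Nat.beq (encE e.2.1 p))) && t1OK A n tp es (p + 1)

/-- (T3) one probe with smallest index `m` and word `x`: every slot value at the key of `x` whose recorded index is
`< m` passes the leaf test on (its pair word) `⊕ x`. (definition) -/
def probeOK (B W : ℕ) (allow : List ℕ) (A n : ℕ) (tp : List ℕ × ℕ) (m x : ℕ) : Bool :=
  (tabFind (gkey A x) tp.1).all fun v => Nat.ble m (decJ v) || mitmLeaf B W allow (pairX n tp.2 (decP v) ^^^ x)

/-- Layer-5 probes: for every indexed row `(i, gᵢ)` and every later pair `(j, k)`: probe `(i, gᵢ ⊕ g_j ⊕ g_k)`.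
(definition, structural) -/
def probe5OK (B W : ℕ) (allow : List ℕ) (A n : ℕ) (tp : List ℕ × ℕ) : List (ℕ × ℕ) → Bool
  | [] => true
  | r :: rest => ((pairXT rest).all fun e => probeOK B W allow A n tp r.1 (r.2 ^^^ e.2.2)) && probe5OK B W allow A n tp rest

/-- The probes of layer `w` (`|u| = w`): `w = 4` pairs, `w = 5` rows extended by a later pair; other layers have no
probes. (definition) -/
def probesOK (B W : ℕ) (allow : List ℕ) (A n : ℕ) (tp : List ℕ × ℕ) (rows : List (ℕ × ℕ)) (w : ℕ) : Bool :=
  if w = 4 then (pairXT rows).all fun e => probeOK B W allow A n tp e.1 e.2.2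
  else if w = 5 then probe5OK B W allow A n tp rows
  else true

/-- The check of layer `w` on column group `g` (of `s = W + 1 − w`) for a matrix `G` systematic on `T`: build the
pair tables keyed by the group, (T1), then the layer's probes. (definition) -/
def mitmLayerOK (n B W : ℕ) (allow G T : List ℕ) (w g : ℕ) : Bool :=
  let A := groupMask n T (W + 1 - w) g
  let rows := idxRows G 0
  let ps := pairXT rows
  let tp := buildTabs A n ps 0 ([], 0)
  t1OK A n tp ps 0 && probesOK B W allow A n tp rows w

/-- The direct test of layer 3: for every indexed row `(i, gᵢ)` and every later pair `(j, k)`, the leaf test on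
`gᵢ ⊕ g_j ⊕ g_k`. (definition, structural) -/
def direct3OK (B W : ℕ) (allow : List ℕ) : List (ℕ × ℕ) → Bool
  | [] => true
  | r :: rest => ((pairXT rest).all fun e => mitmLeaf B W allow (r.2 ^^^ e.2.2)) && direct3OK B W allow rest

/-- The direct part for a matrix of depth `t`: `t ≤ 5`, at most 31 bytes per word (`n ≤ 8·B`, `B ≤ 31`, the range
of `popcFold_eq_popc`), every single row and every pair XOR passes the leaf test, and the side conditions of the
two group families (layers 4, 5) hold. (definition) -/
def mitmDirectOK (n B W : ℕ) (allow G T : List ℕ) (t : ℕ) : Bool :=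
  Nat.ble t 5 && Nat.ble n (8 * B) && Nat.ble B 31 && ((idxRows G 0).all fun r => mitmLeaf B W allow r.2) &&
    ((pairXT (idxRows G 0)).all fun e => mitmLeaf B W allow e.2.2) &&
    groupsOK n T (W + 1 - 4) && groupsOK n T (W + 1 - 5)

/-- Part `p` of the meet-in-the-middle replay of one matrix (`G = giRows Gb mt`): part `0` = the direct part for
layers 1, 2; part `1` = the direct test of layer 3; then the groups of layer 4 (`W − 3` of them) and of layer 5
(`W − 4`); a layer beyond the depth `t` is skipped (`true`), and so is every part past the end. (definition) -/
def mitmPart (n W : ℕ) (allow Gb : List ℕ) (mt : BZMatrix) (p : ℕ) : Bool :=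
  if p = 0 then mitmDirectOK n ((n + 7) / 8) W allow (giRows Gb mt) mt.T mt.t
  else if p = 1 then Nat.blt mt.t 3 || direct3OK ((n + 7) / 8) W allow (idxRows (giRows Gb mt) 0)
  else if p - 2 < W + 1 - 4 then
    Nat.blt mt.t 4 || mitmLayerOK n ((n + 7) / 8) W allow (giRows Gb mt) mt.T 4 (p - 2)
  else if p - 2 - (W + 1 - 4) < W + 1 - 5 then
    Nat.blt mt.t 5 || mitmLayerOK n ((n + 7) / 8) W allow (giRows Gb mt) mt.T 5 (p - 2 - (W + 1 - 4))
  else true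

/-- The number of parts of the replay at threshold `W`: `2 + (W − 3) + (W − 4)`. (definition) -/
def mitmParts (W : ℕ) : ℕ := 2 + (W + 1 - 4) + (W + 1 - 5)

/-- The whole meet-in-the-middle replay of one matrix: all parts. (definition) -/
def matrixEnumOKMitm (n W : ℕ) (allow Gb : List ℕ) (mt : BZMatrix) : Bool :=
  (List.range (mitmParts W)).all fun p => mitmPart n W allow Gb mt p

namespace DistCert

variable (c : DistCert) (z : BZData)

/-- `Z` side, block `b`, matrix `i`, part `p` of the meet-in-the-middle replay at the tight threshold
`W = wEff (dZ − 1)`; `true` past the ends. (definition) -/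
def bzZMitm (b i p : ℕ) : Bool :=
  match z.sideZ.blocks[b]? with
  | none => true
  | some blk =>
    match blk.mats[i]? with
    | none => true
    | some mt => mitmPart c.n (wEff (c.dZ - 1) z.sideZ.evenWitness) (c.sideZ.found.map Prod.fst)
        (gbRows c.HZ z.rcZ z.LZ blk) mt p

/-- `X` side, block `b`, matrix `i`, part `p` of the meet-in-the-middle replay. (definition) -/
def bzXMitm (b i p : ℕ) : Bool :=
  match z.sideX.blocks[b]? with
  | none => true
  | some blk =>
    match blk.mats[i]? with
    | none => true
    | some mt => mitmPart c.n (wEff (c.dX - 1) z.sideX.evenWitness) (c.sideX.found.map Prod.fst)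
        (gbRows c.HX z.rcX z.LX blk) mt p

end DistCert

/-! ## CERT toy: the Steane `bz` certificate of `Census/CertCheckBZ.lean` passes every part -/

/-- Steane, `Z` side, block 0, matrix 0: all parts. -/
theorem bzZMitm_certSteane7 : ∀ p, p < mitmParts 2 → certSteane7.bzZMitm bzSteane 0 0 p = true := by decide

end Summit.Ventures.QEC.Census
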